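import Summits.HodgeConjecture.CorCM.Census.DecicCurveFivefold
import Mathlib.Algebra.BigOperators.Group.List.Basic
import Mathlib.Tactic.Linarith
import HarnessLib

/-!
# Powers `E^c × B₀^a` of the CM curve of `k` and the half-circle CM fivefold of a cyclic decic CM field `F ⊃ k`:
# every Galois-balanced weight, with ANY number of copies, is a disjoint union of lifted conjugate pairs and lifted
# `k`-Weil `6`-sets — the combinatorial census by induction (no `decide` on the configuration)

COR-CM (cell `pub-hodgecm2`), seat b09 gen 18 (2026-08-21); count-neutral own lane DECIC-EB0 (lit-andre-3 ask A6-R22);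
one bookkeeping definition (`ModelBalanced`), theorems otherwise; no named fact, no geometry, no `sorry`.  Companion of
`Census/DecicCurveFivefold.lean` (the 12-point model `Pt = Bool ⊕ ZMod 10` of `Y = E × B₀`, its `ℤ/10`-action `act`,
CM type `phi`, generating weights `conjPair`, `weil6`), in the pattern of seat b30's
`Census/DihedralSexticPairCurvePowers.lean`; consumed by `CorCM/DecicCurveFivefoldPowersTransfer.lean`.

MODEL OF A POWER.  A weight of `X = ⨁_j A₂(κ j)` (`κ : Fin N → Fin 2`, any number of copies of `E = A₂ 0`,
`B₀ = A₂ 1`) is a CONFIGURATION: a finset `T` of an arbitrary type `α` (the index set `⊔_j Hom(K_{κ j}, ℂ)` of `X`) with a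
copy-forgetting model map `v : α → Pt`.  Pohlmann's condition for `X` reads `#{x ∈ T | g · v(x) ∈ Φ} = #{x ∈ T | g · v(x) ∉ Φ}`
for the ten `g ∈ ℤ/10` (`ModelBalanced v T`).

RESULTS.
* `exists_defect_of_modelBalanced` — THE DEFECT LAW: writing `N(y) = #{x ∈ T | v x = y}`, a balanced configuration has
  ONE integer `t` with `N(y) − N(c·y) = t` for EVERY point `y` of the Weil fibre `weil6 false = {inl false, inr 0, inr 2,
  inr 4, inr 6, inr 8}` (five of the ten conditions and the total count; linear algebra by `omega`).  So the Hodge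
  lattice of the whole `{E, B₀}`-slice is `⟨pairs⟩ ⊕ ℤ·(Weil set)`: ONE atom, as in lit-andre-3's
  `Census/DecicCyclicWeilPlanes.subslice_E_B0`, but now as a MONOID statement (no pair has to be deleted);
* `exists_part_of_modelBalanced` — a non-empty balanced configuration contains a PART `G` on which `v` is injective with
  `v(G)` a generating weight (`t > 0`: a lifted `weil6 false`; `t < 0`: a lifted `weil6 true`; `t = 0`: a lifted
  conjugate pair);
* `ModelBalanced.sdiff`, `modelBalanced_of_image_mem_gens`; **`modelBalanced_induction`** — INDUCTION PRINCIPLE: a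
  property of configurations that holds for `∅` and passes from `R` to `G ∪ R` for every disjoint generating part `G`
  holds for every balanced configuration.  For `E^c × B₀^a` this is the combinatorial half of the Hodge conjecture for
  all powers (geometric half: seat b30's distribution lemma `CorCM/CMWeightDistribution.lean` + the Weil plane of the
  sixfold `B₀ × E`, Markman's realm).
[cite: Pohlmann1968, Thm 1] [cite: GaoUllmo2025, Thm 3.1] [cite: Milne2020HodgeClassesAV, 1.2 (a)]

## References
* [Pohlmann1968] H. Pohlmann, Ann. of Math. 88 (1968), Thm 1.  [GaoUllmo2025] Z. Gao, E. Ullmo, J. Inst. Math. Jussieu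
  25 (2025), Thm 3.1.  [Milne2020HodgeClassesAV] J. S. Milne, arXiv:2010.08857, 1.2 (a) and Thm. 1 (André's theorem:
  CM Hodge classes are sums of pull-backs of Weil classes).  [Deligne1982HodgeCycles] P. Deligne, LNM 900, §5 (c).
-/

namespace Summit.HodgeConjecture.CorCM.Census.DecicCurveFivefoldPowers

open Finset
open Summit.HodgeConjecture.CorCM.Census.DecicCurveFivefold (Pt act phi balanced conjPair weil6 gens mem_gens_iff
  mem_conjPair_iff mem_weil6_iff mem_weil6_true_iff mem_weil6_false_iff mem_weil6_true_or_false act_five_weil6_false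
  act_five_mem_weil6_iff gens_balanced isCMType_phi act_inl act_inr)

variable {α : Type*}

/-! ### Balanced configurations -/

/-- **Pohlmann's condition for a configuration** `(T, v)` (a weight of a power `⨁_j A₂(κ j)` read in the 12-point model,
`v` = copy-forgetting model map): for each of the ten `g ∈ ℤ/10`, `#{x ∈ T | g·v(x) ∈ Φ} = #{x ∈ T | g·v(x) ∉ Φ}`.
[cite: GaoUllmo2025, Thm 3.1 eq. (3.2)] -/
def ModelBalanced (v : α → Pt) (T : Finset α) : Prop :=
  ∀ g : ZMod 10, (T.filter fun x => act g (v x) ∈ phi).card = (T.filter fun x => act g (v x) ∉ phi).card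

variable (v : α → Pt)

/-- Unfolding. [cite: GaoUllmo2025, Thm 3.1 eq. (3.2)] -/
theorem modelBalanced_iff (T : Finset α) : ModelBalanced v T ↔ ∀ g : ZMod 10,
    (T.filter fun x => act g (v x) ∈ phi).card = (T.filter fun x => act g (v x) ∉ phi).card :=
  Iff.rfl

/-- Balanced ⟺ twice the `Φ`-count is the size, for every `g`. [cite: GaoUllmo2025, Thm 3.1 eq. (3.2)] -/
theorem modelBalanced_iff_two_mul (T : Finset α) : ModelBalanced v T ↔ ∀ g : ZMod 10,
    2 * (T.filter fun x => act g (v x) ∈ phi).card = T.card := by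
  refine forall_congr' fun g => ?_
  have h := Finset.card_filter_add_card_filter_not (s := T) (fun x => act g (v x) ∈ phi)
  omega

/-- The empty configuration is balanced. [folklore] -/
theorem modelBalanced_empty : ModelBalanced v (∅ : Finset α) := fun _ => by simp

variable {v}

/-- **Removing a balanced part keeps the balance.** [folklore] -/
theorem ModelBalanced.sdiff [DecidableEq α] {T G : Finset α} (hT : ModelBalanced v T) (hG : ModelBalanced v G)
    (hGT : G ⊆ T) : ModelBalanced v (T \ G) := by
  intro g
  have key : ∀ (Q : α → Prop) [DecidablePred Q],
      ((T \ G).filter Q).card = (T.filter Q).card - (G.filter Q).card := by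
    intro Q _
    rw [← Finset.card_sdiff_of_subset (Finset.filter_subset_filter Q hGT)]
    congr 1
    ext x
    simp only [Finset.mem_filter, Finset.mem_sdiff]
    tauto
  rw [key, key, hT g, hG g]

/-- The union of two disjoint balanced configurations is balanced. [folklore] -/
theorem ModelBalanced.union [DecidableEq α] {G R : Finset α} (hG : ModelBalanced v G) (hR : ModelBalanced v R)
    (hGR : Disjoint G R) : ModelBalanced v (G ∪ R) := by
  intro g
  rw [Finset.filter_union, Finset.filter_union,
    Finset.card_union_of_disjoint (Finset.disjoint_filter_filter hGR),
    Finset.card_union_of_disjoint (Finset.disjoint_filter_filter hGR), hG g, hR g]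

/-- Counting through a model map injective on the part: `#{x ∈ G | Q(v x)} = #{y ∈ v(G) | Q y}`. [folklore] -/
theorem card_filter_comp_eq_card_filter_image {G : Finset α} (hinj : Set.InjOn v ↑G) (Q : Pt → Prop)
    [DecidablePred Q] : (G.filter fun x => Q (v x)).card = ((G.image v).filter Q).card := by
  rw [Finset.filter_image, Finset.card_image_of_injOn]
  exact fun x hx y hy h => hinj (Finset.mem_of_mem_filter _ hx) (Finset.mem_of_mem_filter _ hy) h

/-- A part on which `v` is injective with balanced model image is balanced. [cite: GaoUllmo2025, Thm 3.1] -/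
theorem modelBalanced_of_injOn_of_balanced {G : Finset α} (hinj : Set.InjOn v ↑G)
    (hbal : balanced (G.image v) = true) : ModelBalanced v G := by
  intro g
  rw [balanced, decide_eq_true_eq] at hbal
  rw [card_filter_comp_eq_card_filter_image hinj (fun y => act g y ∈ phi),
    card_filter_comp_eq_card_filter_image hinj (fun y => act g y ∉ phi)]
  exact hbal g

/-- **Generating parts are balanced** (the census file's `gens_balanced`). [cite: Deligne1982HodgeCycles, §5 (c)] -/
theorem modelBalanced_of_image_mem_gens {G : Finset α} (hinj : Set.InjOn v ↑G) (hg : G.image v ∈ gens) :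
    ModelBalanced v G := by
  refine modelBalanced_of_injOn_of_balanced hinj ?_
  rcases (mem_gens_iff _).1 hg with ⟨y, hy⟩ | hy | hy <;> rw [hy]
  · exact (gens_balanced.1 y).1
  · exact (gens_balanced.2 true).1
  · exact (gens_balanced.2 false).1

/-! ### Counting fibrewise -/

variable (v)

/-- `#{x ∈ T | Q(v x)} = Σ_{y : Q y} #{x ∈ T | v x = y}`. [folklore] -/
theorem card_filter_comp_eq_sum (T : Finset α) (Q : Pt → Prop) [DecidablePred Q] :
    (T.filter fun x => Q (v x)).card = ∑ y ∈ univ.filter Q, (T.filter fun x => v x = y).card := by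
  rw [Finset.card_eq_sum_card_fiberwise (f := v) (t := univ.filter Q)
    (fun x hx => Finset.mem_filter.2 ⟨Finset.mem_univ _, (Finset.mem_filter.1 hx).2⟩)]
  refine Finset.sum_congr rfl fun y hy => ?_
  have hQy : Q y := (Finset.mem_filter.1 hy).2
  congr 1
  ext x
  simp only [Finset.mem_filter]
  constructor
  · rintro ⟨⟨hx, -⟩, hxy⟩; exact ⟨hx, hxy⟩
  · rintro ⟨hx, hxy⟩; exact ⟨⟨hx, hxy ▸ hQy⟩, hxy⟩

/-- The same with the in-set enumerated by a duplicate-free list: `#{x ∈ T | Q(v x)} = Σ_{y ∈ l} #{x ∈ T | v x = y}`.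
[folklore] -/
theorem card_filter_comp_eq_list_sum (T : Finset α) (Q : Pt → Prop) [DecidablePred Q] (l : List Pt)
    (hl : l.Nodup) (hQ : univ.filter Q = l.toFinset) :
    (T.filter fun x => Q (v x)).card = (l.map fun y => (T.filter fun x => v x = y).card).sum := by
  rw [card_filter_comp_eq_sum, hQ, List.sum_toFinset _ hl]

/-- The total count: `|T| = Σ_y #{x ∈ T | v x = y}` over the twelve model points. [folklore] -/
theorem card_eq_list_sum (T : Finset α) :
    T.card = ([Sum.inl true, Sum.inl false, Sum.inr 0, Sum.inr 1, Sum.inr 2, Sum.inr 3, Sum.inr 4,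
      Sum.inr 5, Sum.inr 6, Sum.inr 7, Sum.inr 8, Sum.inr 9].map
        fun y : Pt => (T.filter fun x => v x = y).card).sum := by
  rw [← card_filter_comp_eq_list_sum v T (fun _ => True) _ (by decide) (by decide)]
  simp

/-! ### The defect law -/

variable {v}

/-- **THE DEFECT LAW of a balanced configuration.**  With `N(y) = #{x ∈ T | v x = y}` there is ONE integer `t` with
`N(y) − N(c·y) = t` for all six points `y` of the Weil fibre `weil6 false = {inl false, inr 0, inr 2, inr 4, inr 6, inr 8}`
(`c = act 5`).  (From the five conditions `g = 0, 2, 4, 6, 8`: the `Φ`-preimage of `g` is `{inl true} ⊔ {inr j | j + g < 5}`,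
a window of five consecutive embeddings containing exactly one of each conjugate pair; consecutive windows differ in
two places; and the total count.) [cite: GaoUllmo2025, Thm 3.1] [cite: Pohlmann1968, Thm 1] -/
theorem exists_defect_of_modelBalanced {T : Finset α} (hT : ModelBalanced v T) : ∃ t : ℤ,
    ((T.filter fun x => v x = Sum.inl false).card : ℤ) - (T.filter fun x => v x = Sum.inl true).card = t ∧
    ((T.filter fun x => v x = Sum.inr 0).card : ℤ) - (T.filter fun x => v x = Sum.inr 5).card = t ∧
    ((T.filter fun x => v x = Sum.inr 2).card : ℤ) - (T.filter fun x => v x = Sum.inr 7).card = t ∧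
    ((T.filter fun x => v x = Sum.inr 4).card : ℤ) - (T.filter fun x => v x = Sum.inr 9).card = t ∧
    ((T.filter fun x => v x = Sum.inr 6).card : ℤ) - (T.filter fun x => v x = Sum.inr 1).card = t ∧
    ((T.filter fun x => v x = Sum.inr 8).card : ℤ) - (T.filter fun x => v x = Sum.inr 3).card = t := by
  have hb := (modelBalanced_iff_two_mul v T).1 hT
  -- the five conditions `g = 0, 2, 4, 6, 8`; in-sets listed as (E,τ) and the window `{j | j + g < 5}`
  have e0 := hb 0
  have e2 := hb 2
  have e4 := hb 4
  have e6 := hb 6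
  have e8 := hb 8
  rw [card_filter_comp_eq_list_sum v T (fun y => act 0 y ∈ phi)
    [Sum.inl true, Sum.inr 0, Sum.inr 1, Sum.inr 2, Sum.inr 3, Sum.inr 4] (by decide) (by decide)] at e0
  rw [card_filter_comp_eq_list_sum v T (fun y => act 2 y ∈ phi)
    [Sum.inl true, Sum.inr 8, Sum.inr 9, Sum.inr 0, Sum.inr 1, Sum.inr 2] (by decide) (by decide)] at e2
  rw [card_filter_comp_eq_list_sum v T (fun y => act 4 y ∈ phi)
    [Sum.inl true, Sum.inr 6, Sum.inr 7, Sum.inr 8, Sum.inr 9, Sum.inr 0] (by decide) (by decide)] at e4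
  rw [card_filter_comp_eq_list_sum v T (fun y => act 6 y ∈ phi)
    [Sum.inl true, Sum.inr 4, Sum.inr 5, Sum.inr 6, Sum.inr 7, Sum.inr 8] (by decide) (by decide)] at e6
  rw [card_filter_comp_eq_list_sum v T (fun y => act 8 y ∈ phi)
    [Sum.inl true, Sum.inr 2, Sum.inr 3, Sum.inr 4, Sum.inr 5, Sum.inr 6] (by decide) (by decide)] at e8
  have etot := card_eq_list_sum v T
  simp only [List.map_cons, List.map_nil, List.sum_cons, List.sum_nil] at etot e0 e2 e4 e6 e8
  refine ⟨((T.filter fun x => v x = Sum.inr 0).card : ℤ) - (T.filter fun x => v x = Sum.inr 5).card,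
    ?_, rfl, ?_, ?_, ?_, ?_⟩ <;> omega

/-! ### Extraction of a generating part -/

/-- A finset of model points all of which are hit by `T` is the injective image of a part of `T`. [folklore] -/
theorem exists_part_of_forall_exists [DecidableEq α] {T : Finset α} (W : Finset Pt)
    (hW : ∀ y ∈ W, ∃ x ∈ T, v x = y) : ∃ G ⊆ T, Set.InjOn v ↑G ∧ G.image v = W := by
  classical
  by_cases hWe : W = ∅
  · subst hWe
    exact ⟨∅, Finset.empty_subset _, fun x hx => absurd hx (by simp), Finset.image_empty _⟩
  obtain ⟨y₀, hy₀⟩ := Finset.nonempty_iff_ne_empty.2 hWe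
  obtain ⟨x₀, -, -⟩ := hW y₀ hy₀
  haveI : Nonempty α := ⟨x₀⟩
  choose! pick hpickT hpickv using hW
  refine ⟨W.image pick, fun x hx => ?_, fun x hx x' hx' hxx' => ?_, ?_⟩
  · obtain ⟨y, hy, rfl⟩ := Finset.mem_image.1 hx
    exact hpickT y hy
  · obtain ⟨y, hy, rfl⟩ := Finset.mem_image.1 (Finset.mem_coe.1 hx)
    obtain ⟨y', hy', rfl⟩ := Finset.mem_image.1 (Finset.mem_coe.1 hx')
    rw [hpickv y hy, hpickv y' hy'] at hxx'
    rw [hxx']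
  · rw [Finset.image_image]
    conv_rhs => rw [← Finset.image_id (s := W)]
    exact Finset.image_congr fun y hy => by simpa using hpickv y (Finset.mem_coe.1 hy)

/-- A model point hit by `T` means a positive fibre count. [folklore] -/
theorem exists_mem_of_card_pos {T : Finset α} {y : Pt} (h : 0 < (T.filter fun x => v x = y).card) :
    ∃ x ∈ T, v x = y := by
  obtain ⟨x, hx⟩ := Finset.card_pos.1 h
  exact ⟨x, (Finset.mem_filter.1 hx).1, (Finset.mem_filter.1 hx).2⟩

/-- **EXTRACTION.**  A non-empty balanced configuration contains a part `G` on which the model map is injective and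
whose image is a generating weight: by the defect law, if `t > 0` every point of `weil6 false` is hit, if `t < 0` every
point of `weil6 true` is hit, and if `t = 0` the conjugate of any hit point is hit (a lifted conjugate pair).
[cite: Milne2020HodgeClassesAV, 1.2 (a) and Thm. 1] [cite: Deligne1982HodgeCycles, §5 (c)] -/
theorem exists_part_of_modelBalanced [DecidableEq α] {T : Finset α} (hT : ModelBalanced v T) (hne : T.Nonempty) :
    ∃ G ⊆ T, G.Nonempty ∧ Set.InjOn v ↑G ∧ G.image v ∈ gens := by
  obtain ⟨t, hE, h0, h2, h4, h6, h8⟩ := exists_defect_of_modelBalanced hT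
  -- an opaque name for the twelve counts
  obtain ⟨N, hN⟩ : ∃ N : Pt → ℕ, ∀ y, (T.filter fun x => v x = y).card = N y := ⟨_, fun _ => rfl⟩
  simp only [hN] at hE h0 h2 h4 h6 h8
  have hit : ∀ y, 0 < N y → ∃ x ∈ T, v x = y := fun y hy => exists_mem_of_card_pos (v := v) (by rw [hN]; exact hy)
  -- a generating weight all of whose points are hit gives the part
  have conclude : ∀ W ∈ gens, W.Nonempty → (∀ y ∈ W, 0 < N y) →
      ∃ G ⊆ T, G.Nonempty ∧ Set.InjOn v ↑G ∧ G.image v ∈ gens := by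
    intro W hW hWne hWhit
    obtain ⟨G, hGT, hinj, hGW⟩ := exists_part_of_forall_exists W fun y hy => hit y (hWhit y hy)
    refine ⟨G, hGT, ?_, hinj, hGW ▸ hW⟩
    obtain ⟨y, hy⟩ := hWne
    rw [← hGW] at hy
    obtain ⟨x, hx, -⟩ := Finset.mem_image.1 hy
    exact ⟨x, hx⟩
  have hgens6 : ∀ b, weil6 b ∈ gens := fun b => by
    cases b
    · exact (mem_gens_iff _).2 (Or.inr (Or.inr rfl))
    · exact (mem_gens_iff _).2 (Or.inr (Or.inl rfl))
  have hgens2 : ∀ y, conjPair y ∈ gens := fun y => (mem_gens_iff _).2 (Or.inl ⟨y, rfl⟩)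
  have hne6 : ∀ b, (weil6 b).Nonempty := fun b => ⟨Sum.inl b, (mem_weil6_iff b _).2 (Or.inl rfl)⟩
  have hne2 : ∀ y, (conjPair y).Nonempty := fun y => ⟨y, (mem_conjPair_iff _ _).2 (Or.inl rfl)⟩
  -- the defect law, quantified over the fibre of `τ̄`
  have hdef : ∀ y ∈ weil6 false, (N y : ℤ) - N (act 5 y) = t := by
    intro y hy
    obtain ⟨c1, c2, c3, c4, c5, c6⟩ := act_five_weil6_false
    rcases (mem_weil6_false_iff y).1 hy with rfl | rfl | rfl | rfl | rfl | rfl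
    · rw [c1]; exact hE
    · rw [c2]; exact h0
    · rw [c3]; exact h2
    · rw [c4]; exact h4
    · rw [c5]; exact h6
    · rw [c6]; exact h8
  have hcc : ∀ y : Pt, act 5 (act 5 y) = y := isCMType_phi.2.1
  -- on the fibre of `τ`: `N(c·y) − N(y) = t`
  have hdef' : ∀ y ∈ weil6 true, (N (act 5 y) : ℤ) - N y = t := by
    intro y hy
    have h := hdef (act 5 y) ((act_five_mem_weil6_iff true y).2 hy)
    rwa [hcc] at h
  -- case analysis on the sign of the defect
  by_cases ht : 0 < t
  · -- every point of the fibre of `τ̄` is hit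
    refine conclude _ (hgens6 false) (hne6 false) fun y hy => ?_
    have h := hdef y hy
    omega
  by_cases ht' : t < 0
  · -- every point of the fibre of `τ` is hit
    refine conclude _ (hgens6 true) (hne6 true) fun y hy => ?_
    have h := hdef' y hy
    omega
  -- `t = 0`: the conjugate of a hit point is hit
  have ht0 : t = 0 := by omega
  obtain ⟨x, hx⟩ := hne
  have hNx : 0 < N (v x) := by
    rw [← hN]
    exact Finset.card_pos.2 ⟨x, Finset.mem_filter.2 ⟨hx, rfl⟩⟩
  refine conclude _ (hgens2 (v x)) (hne2 (v x)) fun y hy => ?_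
  rcases (mem_conjPair_iff _ _).1 hy with rfl | rfl
  · exact hNx
  · -- the conjugate point `c · v x`
    rcases (mem_weil6_true_or_false (v x)).1 with h | h
    · have h' := hdef' _ h
      omega
    · have h' := hdef _ h
      omega

/-! ### The induction principle -/

/-- **INDUCTION PRINCIPLE FOR BALANCED CONFIGURATIONS (any number of copies).**  Let `motive` hold for the empty
configuration and pass from `R` to `G ∪ R` whenever `G` is disjoint from `R`, the model map is injective on `G` and
`v(G)` is a generating weight of the 12-point model (a conjugate pair or a `k`-Weil `6`-set).  Then `motive` holds for
every balanced configuration: by extraction, a non-empty balanced `T` is `G ⊔ (T ∖ G)` with `G` a generating part, and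
`T ∖ G` is balanced and smaller. [cite: Milne2020HodgeClassesAV, 1.2 (a) and Thm. 1] [cite: GaoUllmo2025, Thm 3.1] -/
theorem modelBalanced_induction [DecidableEq α] {motive : Finset α → Prop} (h0 : motive ∅)
    (hstep : ∀ G R : Finset α, Disjoint G R → Set.InjOn v ↑G → G.image v ∈ gens → motive R → motive (G ∪ R))
    {T : Finset α} (hT : ModelBalanced v T) : motive T := by
  induction T using Finset.strongInduction with
  | H T ih =>
    by_cases hTe : T = ∅
    · subst hTe; exact h0
    obtain ⟨G, hGT, hGne, hinj, hG⟩ := exists_part_of_modelBalanced hT (Finset.nonempty_iff_ne_empty.2 hTe)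
    have hR : ModelBalanced v (T \ G) := hT.sdiff (modelBalanced_of_image_mem_gens hinj hG) hGT
    have hlt : T \ G ⊂ T := Finset.sdiff_ssubset hGT hGne
    have h := hstep G (T \ G) Finset.disjoint_sdiff hinj hG (ih _ hlt hR)
    rwa [Finset.union_sdiff_of_subset hGT] at h

/-- **Corollary (one copy of each factor): the kernel census re-derived** — a balanced weight of the 12-point model
itself (`v = id`) is reached by the induction, i.e. is a disjoint union of generating weights.
[cite: GaoUllmo2025, Thm 3.1] -/
theorem modelBalanced_id_iff (S : Finset Pt) : ModelBalanced id S ↔ balanced S = true := by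
  rw [ModelBalanced, balanced, decide_eq_true_eq]
  rfl

end Summit.HodgeConjecture.CorCM.Census.DecicCurveFivefoldPowers
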